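import Summits.Ventures.PercRepro.S1CFGDepFour
import Summits.Ventures.PercRepro.S1CFGTrianglesChainValues

/-!
# PercRepro — THE SIMPLE CHAIN WITH THE DEPENDENT-`4`-SET CAP, BY NUMBER (p1, gen 40)

The low-rank set counts of a simple coloop-free matroid of nullity `ν` on `n` points, with the cap
`D₄ ≤ C(ν + 1, 4) + (n − ν − 1)·C(ν + 1, 3) + C(ν + 1, 2) + (n − 3)` (S1CFGDepFour) in place of the chain's
`(n − 3)·c₃ + c₄`, propagated through the landed double counts (S1CFGSimpleFive, S1CFGSix):
`(c₃, Q₄², c₄, D₄, Q₅², Q₅³, Q₅⁴ [; Q₆², Q₆³, Q₆⁴, Q₆⁵])` at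
`(5, 11)`: `(21, 15, 55, 138, 6, 103, 346)` · `(5, 12)`: `(21, 15, 52, 159, 6, 119, 523)` ·
`(5, 13)`: `(21, 15, 50, 180, 6, 135, 752)` · `(6, 12)`: `(36, 36, 105, 240, 21, 249, 639; 7, 149, 716, 1405)` ·
`(6, 13)`: `(36, 36, 101, 276, 21, 285, 935; 7, 170, 1003, 2319)` · `(6, 14)`: `(36, 36, 98, 312, 21, 321, 1313; 7, 192, 1356, 3637)`
— against the landed `D₄ = 223 / 241 / 260 / 429 / 461 / 494` and `Q₅³ = 154 / 168 / 183 / 397 / 433 / 467`.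
The simple residuals of the rows `p = 11, 12` at `q = 5` (p7's kit). Nothing about any cell is claimed. Axioms: standard.
-/

open scoped Matroid

namespace PercRepro

namespace S1CFG

open Set S1CF

variable {α : Type}

/-- **The chain with the `D₄` cap at `(ν, n) = (5, 11)`**: `c₃ ≤ 21`, `Q₄² ≤ 15`, `c₄ ≤ 55`, `D₄ ≤ 138`, `Q₅² ≤ 6`,
`Q₅³ ≤ 103`, `Q₅⁴ ≤ 346`. -/
theorem depchain_five_eleven (M : Matroid α) [M.Finite] (hK : ∀ e, ¬ M.IsColoop e)
    (hd : M.E.encard = M.eRank + ((5 : ℕ) : ℕ∞))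
    (h0 : {P : Set α | P ⊆ M.E ∧ P.ncard = 2 ∧ M.Dep P}.ncard = 0) (hn : M.E.ncard = 11) :
    {X : Set α | X ⊆ M.E ∧ X.ncard = 3 ∧ M.eRk X ≤ 2}.ncard ≤ 21 ∧
    {X : Set α | X ⊆ M.E ∧ X.ncard = 4 ∧ M.eRk X ≤ 2}.ncard ≤ 15 ∧
    {X : Set α | X ⊆ M.E ∧ X.ncard = 4 ∧ M.IsCircuit X}.ncard ≤ 55 ∧
    {X : Set α | X ⊆ M.E ∧ X.ncard = 4 ∧ M.eRk X ≤ 3}.ncard ≤ 138 ∧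
    {X : Set α | X ⊆ M.E ∧ X.ncard = 5 ∧ M.eRk X ≤ 2}.ncard ≤ 6 ∧
    {X : Set α | X ⊆ M.E ∧ X.ncard = 5 ∧ M.eRk X ≤ 3}.ncard ≤ 103 ∧
    {X : Set α | X ⊆ M.E ∧ X.ncard = 5 ∧ M.eRk X ≤ 4}.ncard ≤ 346 := by
  have hr : (M.eRk M.E).toNat = 6 := by
    have := ncard_ground_eq_eRk_toNat_add M hd
    omega
  have h3 := triangles_le_twentyone_of_nullity_five'' M hd hK h0 (by omega)
  have h42 := four_mul_ncard_four_eRk_le_two_le_mul M hK hd h0 (by omega)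
  have h4 := ncard_fourCircuits_le_div M hK hd (by omega)
  have h4' : {X : Set α | X ⊆ M.E ∧ X.ncard = 4 ∧ M.IsCircuit X}.ncard ≤ 55 := by
    rw [hn] at h4
    exact h4.trans (by decide)
  have hD4 := ncard_four_eRk_le_three_le_cap M hd hK h0 (by norm_num)
  have h52 := five_mul_ncard_five_eRk_le_two_le_of_no_dep_pair M hK hd h0 (by omega)
  have h53 := five_mul_ncard_five_eRk_le_three_le M hK hd (by omega)
  have h54 := five_mul_ncard_five_eRk_le_four_le_exact M hK hd (by omega)
  rw [hn] at hD4 h53 h54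
  rw [show Nat.choose 11 4 = 330 by decide] at h54
  simp only [show (5 + 1).choose 4 = 15 by decide, show (5 + 1).choose 3 = 20 by decide,
    show (5 + 1).choose 2 = 15 by decide] at hD4
  omega

/-- **The chain with the `D₄` cap at `(ν, n) = (5, 12)`**: `c₃ ≤ 21`, `Q₄² ≤ 15`, `c₄ ≤ 52`, `D₄ ≤ 159`, `Q₅² ≤ 6`,
`Q₅³ ≤ 119`, `Q₅⁴ ≤ 523`. -/
theorem depchain_five_twelve (M : Matroid α) [M.Finite] (hK : ∀ e, ¬ M.IsColoop e)
    (hd : M.E.encard = M.eRank + ((5 : ℕ) : ℕ∞))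
    (h0 : {P : Set α | P ⊆ M.E ∧ P.ncard = 2 ∧ M.Dep P}.ncard = 0) (hn : M.E.ncard = 12) :
    {X : Set α | X ⊆ M.E ∧ X.ncard = 3 ∧ M.eRk X ≤ 2}.ncard ≤ 21 ∧
    {X : Set α | X ⊆ M.E ∧ X.ncard = 4 ∧ M.eRk X ≤ 2}.ncard ≤ 15 ∧
    {X : Set α | X ⊆ M.E ∧ X.ncard = 4 ∧ M.IsCircuit X}.ncard ≤ 52 ∧
    {X : Set α | X ⊆ M.E ∧ X.ncard = 4 ∧ M.eRk X ≤ 3}.ncard ≤ 159 ∧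
    {X : Set α | X ⊆ M.E ∧ X.ncard = 5 ∧ M.eRk X ≤ 2}.ncard ≤ 6 ∧
    {X : Set α | X ⊆ M.E ∧ X.ncard = 5 ∧ M.eRk X ≤ 3}.ncard ≤ 119 ∧
    {X : Set α | X ⊆ M.E ∧ X.ncard = 5 ∧ M.eRk X ≤ 4}.ncard ≤ 523 := by
  have hr : (M.eRk M.E).toNat = 7 := by
    have := ncard_ground_eq_eRk_toNat_add M hd
    omega
  have h3 := triangles_le_twentyone_of_nullity_five'' M hd hK h0 (by omega)
  have h42 := four_mul_ncard_four_eRk_le_two_le_mul M hK hd h0 (by omega)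
  have h4 := ncard_fourCircuits_le_div M hK hd (by omega)
  have h4' : {X : Set α | X ⊆ M.E ∧ X.ncard = 4 ∧ M.IsCircuit X}.ncard ≤ 52 := by
    rw [hn] at h4
    exact h4.trans (by decide)
  have hD4 := ncard_four_eRk_le_three_le_cap M hd hK h0 (by norm_num)
  have h52 := five_mul_ncard_five_eRk_le_two_le_of_no_dep_pair M hK hd h0 (by omega)
  have h53 := five_mul_ncard_five_eRk_le_three_le M hK hd (by omega)
  have h54 := five_mul_ncard_five_eRk_le_four_le_exact M hK hd (by omega)
  rw [hn] at hD4 h53 h54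
  rw [show Nat.choose 12 4 = 495 by decide] at h54
  simp only [show (5 + 1).choose 4 = 15 by decide, show (5 + 1).choose 3 = 20 by decide,
    show (5 + 1).choose 2 = 15 by decide] at hD4
  omega

/-- **The chain with the `D₄` cap at `(ν, n) = (5, 13)`**: `c₃ ≤ 21`, `Q₄² ≤ 15`, `c₄ ≤ 50`, `D₄ ≤ 180`, `Q₅² ≤ 6`,
`Q₅³ ≤ 135`, `Q₅⁴ ≤ 752`. -/
theorem depchain_five_thirteen (M : Matroid α) [M.Finite] (hK : ∀ e, ¬ M.IsColoop e)
    (hd : M.E.encard = M.eRank + ((5 : ℕ) : ℕ∞))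
    (h0 : {P : Set α | P ⊆ M.E ∧ P.ncard = 2 ∧ M.Dep P}.ncard = 0) (hn : M.E.ncard = 13) :
    {X : Set α | X ⊆ M.E ∧ X.ncard = 3 ∧ M.eRk X ≤ 2}.ncard ≤ 21 ∧
    {X : Set α | X ⊆ M.E ∧ X.ncard = 4 ∧ M.eRk X ≤ 2}.ncard ≤ 15 ∧
    {X : Set α | X ⊆ M.E ∧ X.ncard = 4 ∧ M.IsCircuit X}.ncard ≤ 50 ∧
    {X : Set α | X ⊆ M.E ∧ X.ncard = 4 ∧ M.eRk X ≤ 3}.ncard ≤ 180 ∧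
    {X : Set α | X ⊆ M.E ∧ X.ncard = 5 ∧ M.eRk X ≤ 2}.ncard ≤ 6 ∧
    {X : Set α | X ⊆ M.E ∧ X.ncard = 5 ∧ M.eRk X ≤ 3}.ncard ≤ 135 ∧
    {X : Set α | X ⊆ M.E ∧ X.ncard = 5 ∧ M.eRk X ≤ 4}.ncard ≤ 752 := by
  have hr : (M.eRk M.E).toNat = 8 := by
    have := ncard_ground_eq_eRk_toNat_add M hd
    omega
  have h3 := triangles_le_twentyone_of_nullity_five'' M hd hK h0 (by omega)
  have h42 := four_mul_ncard_four_eRk_le_two_le_mul M hK hd h0 (by omega)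
  have h4 := ncard_fourCircuits_le_div M hK hd (by omega)
  have h4' : {X : Set α | X ⊆ M.E ∧ X.ncard = 4 ∧ M.IsCircuit X}.ncard ≤ 50 := by
    rw [hn] at h4
    exact h4.trans (by decide)
  have hD4 := ncard_four_eRk_le_three_le_cap M hd hK h0 (by norm_num)
  have h52 := five_mul_ncard_five_eRk_le_two_le_of_no_dep_pair M hK hd h0 (by omega)
  have h53 := five_mul_ncard_five_eRk_le_three_le M hK hd (by omega)
  have h54 := five_mul_ncard_five_eRk_le_four_le_exact M hK hd (by omega)
  rw [hn] at hD4 h53 h54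
  rw [show Nat.choose 13 4 = 715 by decide] at h54
  simp only [show (5 + 1).choose 4 = 15 by decide, show (5 + 1).choose 3 = 20 by decide,
    show (5 + 1).choose 2 = 15 by decide] at hD4
  omega

/-- **The chain with the `D₄` cap at `(ν, n) = (6, 12)`**: `c₃ ≤ 36`, `Q₄² ≤ 36`, `c₄ ≤ 105`, `D₄ ≤ 240`, `Q₅² ≤ 21`,
`Q₅³ ≤ 249`, `Q₅⁴ ≤ 639`, `Q₆² ≤ 7`, `Q₆³ ≤ 149`, `Q₆⁴ ≤ 716`, `Q₆⁵ ≤ 1405`. -/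
theorem depchain_six_twelve (M : Matroid α) [M.Finite] (hK : ∀ e, ¬ M.IsColoop e)
    (hd : M.E.encard = M.eRank + ((6 : ℕ) : ℕ∞))
    (h0 : {P : Set α | P ⊆ M.E ∧ P.ncard = 2 ∧ M.Dep P}.ncard = 0) (hn : M.E.ncard = 12) :
    {X : Set α | X ⊆ M.E ∧ X.ncard = 3 ∧ M.eRk X ≤ 2}.ncard ≤ 36 ∧
    {X : Set α | X ⊆ M.E ∧ X.ncard = 4 ∧ M.eRk X ≤ 2}.ncard ≤ 36 ∧
    {X : Set α | X ⊆ M.E ∧ X.ncard = 4 ∧ M.IsCircuit X}.ncard ≤ 105 ∧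
    {X : Set α | X ⊆ M.E ∧ X.ncard = 4 ∧ M.eRk X ≤ 3}.ncard ≤ 240 ∧
    {X : Set α | X ⊆ M.E ∧ X.ncard = 5 ∧ M.eRk X ≤ 2}.ncard ≤ 21 ∧
    {X : Set α | X ⊆ M.E ∧ X.ncard = 5 ∧ M.eRk X ≤ 3}.ncard ≤ 249 ∧
    {X : Set α | X ⊆ M.E ∧ X.ncard = 5 ∧ M.eRk X ≤ 4}.ncard ≤ 639 ∧
    {X : Set α | X ⊆ M.E ∧ X.ncard = 6 ∧ M.eRk X ≤ 2}.ncard ≤ 7 ∧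
    {X : Set α | X ⊆ M.E ∧ X.ncard = 6 ∧ M.eRk X ≤ 3}.ncard ≤ 149 ∧
    {X : Set α | X ⊆ M.E ∧ X.ncard = 6 ∧ M.eRk X ≤ 4}.ncard ≤ 716 ∧
    {X : Set α | X ⊆ M.E ∧ X.ncard = 6 ∧ M.eRk X ≤ 5}.ncard ≤ 1405 := by
  have hr : (M.eRk M.E).toNat = 6 := by
    have := ncard_ground_eq_eRk_toNat_add M hd
    omega
  have h3 := triangles_le_thirtysix_of_nullity_six'' M hd hK h0 (by omega)
  have h42 := four_mul_ncard_four_eRk_le_two_le_mul M hK hd h0 (by omega)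
  have h4 := ncard_fourCircuits_le_div M hK hd (by omega)
  have h4' : {X : Set α | X ⊆ M.E ∧ X.ncard = 4 ∧ M.IsCircuit X}.ncard ≤ 105 := by
    rw [hn] at h4
    exact h4.trans (by decide)
  have hD4 := ncard_four_eRk_le_three_le_cap M hd hK h0 (by norm_num)
  have h52 := five_mul_ncard_five_eRk_le_two_le_of_no_dep_pair M hK hd h0 (by omega)
  have h53 := five_mul_ncard_five_eRk_le_three_le M hK hd (by omega)
  have h54 := five_mul_ncard_five_eRk_le_four_le_exact M hK hd (by omega)
  have h51 := ncard_five_eRk_le_one_eq_zero_of_no_dep_pair M h0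
  have h62 := six_mul_ncard_six_eRk_le_two_le M hK hd (by omega)
  have h63 := six_mul_ncard_six_eRk_le_three_le M hK hd (by omega)
  have h64 := six_mul_ncard_six_eRk_le_four_le M hK hd (by omega)
  have h65 := six_mul_ncard_six_eRk_le_five_le M hK hd (by omega)
  rw [hn] at hD4 h53 h54 h62 h63 h64 h65
  rw [show Nat.choose 12 4 = 495 by decide] at h54
  rw [show Nat.choose 12 5 = 792 by decide] at h65
  rw [h51] at h62
  simp only [show (6 + 1).choose 4 = 35 by decide, show (6 + 1).choose 3 = 35 by decide,
    show (6 + 1).choose 2 = 21 by decide] at hD4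
  omega

/-- **The chain with the `D₄` cap at `(ν, n) = (6, 13)`**: `c₃ ≤ 36`, `Q₄² ≤ 36`, `c₄ ≤ 101`, `D₄ ≤ 276`, `Q₅² ≤ 21`,
`Q₅³ ≤ 285`, `Q₅⁴ ≤ 935`, `Q₆² ≤ 7`, `Q₆³ ≤ 170`, `Q₆⁴ ≤ 1003`, `Q₆⁵ ≤ 2319`. -/
theorem depchain_six_thirteen (M : Matroid α) [M.Finite] (hK : ∀ e, ¬ M.IsColoop e)
    (hd : M.E.encard = M.eRank + ((6 : ℕ) : ℕ∞))
    (h0 : {P : Set α | P ⊆ M.E ∧ P.ncard = 2 ∧ M.Dep P}.ncard = 0) (hn : M.E.ncard = 13) :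
    {X : Set α | X ⊆ M.E ∧ X.ncard = 3 ∧ M.eRk X ≤ 2}.ncard ≤ 36 ∧
    {X : Set α | X ⊆ M.E ∧ X.ncard = 4 ∧ M.eRk X ≤ 2}.ncard ≤ 36 ∧
    {X : Set α | X ⊆ M.E ∧ X.ncard = 4 ∧ M.IsCircuit X}.ncard ≤ 101 ∧
    {X : Set α | X ⊆ M.E ∧ X.ncard = 4 ∧ M.eRk X ≤ 3}.ncard ≤ 276 ∧
    {X : Set α | X ⊆ M.E ∧ X.ncard = 5 ∧ M.eRk X ≤ 2}.ncard ≤ 21 ∧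
    {X : Set α | X ⊆ M.E ∧ X.ncard = 5 ∧ M.eRk X ≤ 3}.ncard ≤ 285 ∧
    {X : Set α | X ⊆ M.E ∧ X.ncard = 5 ∧ M.eRk X ≤ 4}.ncard ≤ 935 ∧
    {X : Set α | X ⊆ M.E ∧ X.ncard = 6 ∧ M.eRk X ≤ 2}.ncard ≤ 7 ∧
    {X : Set α | X ⊆ M.E ∧ X.ncard = 6 ∧ M.eRk X ≤ 3}.ncard ≤ 170 ∧
    {X : Set α | X ⊆ M.E ∧ X.ncard = 6 ∧ M.eRk X ≤ 4}.ncard ≤ 1003 ∧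
    {X : Set α | X ⊆ M.E ∧ X.ncard = 6 ∧ M.eRk X ≤ 5}.ncard ≤ 2319 := by
  have hr : (M.eRk M.E).toNat = 7 := by
    have := ncard_ground_eq_eRk_toNat_add M hd
    omega
  have h3 := triangles_le_thirtysix_of_nullity_six'' M hd hK h0 (by omega)
  have h42 := four_mul_ncard_four_eRk_le_two_le_mul M hK hd h0 (by omega)
  have h4 := ncard_fourCircuits_le_div M hK hd (by omega)
  have h4' : {X : Set α | X ⊆ M.E ∧ X.ncard = 4 ∧ M.IsCircuit X}.ncard ≤ 101 := by
    rw [hn] at h4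
    exact h4.trans (by decide)
  have hD4 := ncard_four_eRk_le_three_le_cap M hd hK h0 (by norm_num)
  have h52 := five_mul_ncard_five_eRk_le_two_le_of_no_dep_pair M hK hd h0 (by omega)
  have h53 := five_mul_ncard_five_eRk_le_three_le M hK hd (by omega)
  have h54 := five_mul_ncard_five_eRk_le_four_le_exact M hK hd (by omega)
  have h51 := ncard_five_eRk_le_one_eq_zero_of_no_dep_pair M h0
  have h62 := six_mul_ncard_six_eRk_le_two_le M hK hd (by omega)
  have h63 := six_mul_ncard_six_eRk_le_three_le M hK hd (by omega)
  have h64 := six_mul_ncard_six_eRk_le_four_le M hK hd (by omega)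
  have h65 := six_mul_ncard_six_eRk_le_five_le M hK hd (by omega)
  rw [hn] at hD4 h53 h54 h62 h63 h64 h65
  rw [show Nat.choose 13 4 = 715 by decide] at h54
  rw [show Nat.choose 13 5 = 1287 by decide] at h65
  rw [h51] at h62
  simp only [show (6 + 1).choose 4 = 35 by decide, show (6 + 1).choose 3 = 35 by decide,
    show (6 + 1).choose 2 = 21 by decide] at hD4
  omega

/-- **The chain with the `D₄` cap at `(ν, n) = (6, 14)`**: `c₃ ≤ 36`, `Q₄² ≤ 36`, `c₄ ≤ 98`, `D₄ ≤ 312`, `Q₅² ≤ 21`,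
`Q₅³ ≤ 321`, `Q₅⁴ ≤ 1313`, `Q₆² ≤ 7`, `Q₆³ ≤ 192`, `Q₆⁴ ≤ 1356`, `Q₆⁵ ≤ 3637`. -/
theorem depchain_six_fourteen (M : Matroid α) [M.Finite] (hK : ∀ e, ¬ M.IsColoop e)
    (hd : M.E.encard = M.eRank + ((6 : ℕ) : ℕ∞))
    (h0 : {P : Set α | P ⊆ M.E ∧ P.ncard = 2 ∧ M.Dep P}.ncard = 0) (hn : M.E.ncard = 14) :
    {X : Set α | X ⊆ M.E ∧ X.ncard = 3 ∧ M.eRk X ≤ 2}.ncard ≤ 36 ∧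
    {X : Set α | X ⊆ M.E ∧ X.ncard = 4 ∧ M.eRk X ≤ 2}.ncard ≤ 36 ∧
    {X : Set α | X ⊆ M.E ∧ X.ncard = 4 ∧ M.IsCircuit X}.ncard ≤ 98 ∧
    {X : Set α | X ⊆ M.E ∧ X.ncard = 4 ∧ M.eRk X ≤ 3}.ncard ≤ 312 ∧
    {X : Set α | X ⊆ M.E ∧ X.ncard = 5 ∧ M.eRk X ≤ 2}.ncard ≤ 21 ∧
    {X : Set α | X ⊆ M.E ∧ X.ncard = 5 ∧ M.eRk X ≤ 3}.ncard ≤ 321 ∧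
    {X : Set α | X ⊆ M.E ∧ X.ncard = 5 ∧ M.eRk X ≤ 4}.ncard ≤ 1313 ∧
    {X : Set α | X ⊆ M.E ∧ X.ncard = 6 ∧ M.eRk X ≤ 2}.ncard ≤ 7 ∧
    {X : Set α | X ⊆ M.E ∧ X.ncard = 6 ∧ M.eRk X ≤ 3}.ncard ≤ 192 ∧
    {X : Set α | X ⊆ M.E ∧ X.ncard = 6 ∧ M.eRk X ≤ 4}.ncard ≤ 1356 ∧
    {X : Set α | X ⊆ M.E ∧ X.ncard = 6 ∧ M.eRk X ≤ 5}.ncard ≤ 3637 := by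
  have hr : (M.eRk M.E).toNat = 8 := by
    have := ncard_ground_eq_eRk_toNat_add M hd
    omega
  have h3 := triangles_le_thirtysix_of_nullity_six'' M hd hK h0 (by omega)
  have h42 := four_mul_ncard_four_eRk_le_two_le_mul M hK hd h0 (by omega)
  have h4 := ncard_fourCircuits_le_div M hK hd (by omega)
  have h4' : {X : Set α | X ⊆ M.E ∧ X.ncard = 4 ∧ M.IsCircuit X}.ncard ≤ 98 := by
    rw [hn] at h4
    exact h4.trans (by decide)
  have hD4 := ncard_four_eRk_le_three_le_cap M hd hK h0 (by norm_num)
  have h52 := five_mul_ncard_five_eRk_le_two_le_of_no_dep_pair M hK hd h0 (by omega)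
  have h53 := five_mul_ncard_five_eRk_le_three_le M hK hd (by omega)
  have h54 := five_mul_ncard_five_eRk_le_four_le_exact M hK hd (by omega)
  have h51 := ncard_five_eRk_le_one_eq_zero_of_no_dep_pair M h0
  have h62 := six_mul_ncard_six_eRk_le_two_le M hK hd (by omega)
  have h63 := six_mul_ncard_six_eRk_le_three_le M hK hd (by omega)
  have h64 := six_mul_ncard_six_eRk_le_four_le M hK hd (by omega)
  have h65 := six_mul_ncard_six_eRk_le_five_le M hK hd (by omega)
  rw [hn] at hD4 h53 h54 h62 h63 h64 h65
  rw [show Nat.choose 14 4 = 1001 by decide] at h54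
  rw [show Nat.choose 14 5 = 2002 by decide] at h65
  rw [h51] at h62
  simp only [show (6 + 1).choose 4 = 35 by decide, show (6 + 1).choose 3 = 35 by decide,
    show (6 + 1).choose 2 = 21 by decide] at hD4
  omega

end S1CFG

end PercRepro
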